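import Summits.QuantumFields.YangMills.Theorems.BalabanUVNodesN22ActivityStripSlot
import Literature.MathematicalPhysics.QuantumFieldTheory.Balaban1983to89.B12CouplingClausesHistory

/-!
# BalabanUVNodes ∕ node N22 = NE9 — THE MIXED SLOT of ROAD 3: the activity-strip slot (`BalabanUVNodesN22ActivityStripSlot`) on the OLDER
# couplings + an OUTPUT-level sup letter on the LAST coupling (node N09's per-step `EHoloAt` currency, seat n22-d's
# `BalabanUVNodesN22LastCouplingHolo`) ⟹ the (A) letter for every young coupling ⟹ `N22At`, and the tower form with node N18 below

Cell `pub-ymgap`, HUMAN RULING D-0062 (Track A), R134 fan-out seat `pub-ymgap-dag-n22-c` (strategy s1), generation 0, second module (the gate caps a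
Theorems file with proofs at 400 lines, so §4 of the slot module's planned v1.1 is this file).  THEOREMS ONLY (no `def`, no `def … : Prop`);
imports this seat's `…Theorems.BalabanUVNodesN22ActivityStripSlot` (p452837: `exists_holo_extension_of_re`, `n22At_of_oscAnalytic` via
`…N22AtRecordAnalytic`, S25 via `NE1p.DressedOutputAnalyticFaces`) BY NAME.  `--supports stmt-QuantumFields-19676` (K3 `SpineGivenEndpointR11`).

WHY (print's dichotomy).  [II] p. 12 (2.3): the small-field cut-off `χ(|B(b)| < ε₁∕g_k)` reads the LAST coupling only; an OLDER coupling
`g_i`, `i < k`, enters the activities (2.14) p. 15 only through the potentials `𝐕_k(Y, B)` of the earlier actions ((1.33) p. 9).  So complexifying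
an OLDER coupling never meets the cut-off — the activity-strip slot is its natural currency — while the LAST coupling's currency is the
OUTPUT-level letter of [I] p. 263 *"It is a C^∞-function of g_{j−1} ∈ [0, γ], (or analytic)"*, delivered per step by node N09
(`B12BetaHolo.EHoloAt`; n22-d's `supLetter_lastCoupling_of_eHolo` = the `i = scale − 1` clause with `M = E₀`).  This file glues the two
currencies into the uniform `hA` clause of ROAD 3 (`YMDAG.N22.n22At_of_oscAnalytic`) — the «merge lemma» of dag-lead's word to n22-d
(bus 2026-08-26 ≈14:58Z) in its ABSTRACT form over `T4OutputRate.Carriers` ∕ `Functional`; the `EHoloAt` instance is one `exact` in n22-d's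
currency.

WHAT.
* §1 `supLetter_of_activityStripOlder_lastLetter` — activity-strip slot on `i + 1 < scale X` + an output-level (A) letter with constant `M_last`
  on `i + 1 = scale X`, common margin `r`, any `M ≥ max(e·9·64·K₀(64,8)²·A, M_last)` ⟹ the (A) letter for EVERY `i < scale X` with `μ = 1`.
* `n22At_of_oscActivityStripOlder_lastLetter` — (P) + (O) at the bundle's NE5 rate `0 < θ ≤ 1` + the mixed slot ⟹ `N22At u` (rate `θ^{1−s}`,
  `n22At_of_oscAnalytic` BY NAME).
* `n22At_level_of_n18At_below_activityStripOlder_lastLetter` — the tower form: node N18 BY NAME at the levels `k′ < k` + (P) + the mixed slot at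
  level `k` (`n22At_level_of_n18At_below_analytic` BY NAME).
* §2 (v1.1) `analyticInEachCoupling266_of_activityStrip` — THE DIRECTION OF RECORD: the activity-strip slot IMPLIES the PRINTED coupling-regularity
  clause of [I] p. 266 *"𝐄^{(j)}, β_j are analytic functions of the effective coupling constants"* in the history-explicit typing of the Bałaban
  literature typer (`B12CouplingClausesHistory.AnalyticInEachCoupling266 (Window γ) (Ioc 0 γ) scale (fun _ => univ) E`, via its
  `analyticInEachCoupling266_of_openDiscs`); the converse (print's qualitative type ⇒ a quantitative letter) is NE9's unprinted content and is NOT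
  claimed.

VERSIONS.  v1 (p455244, commit 000139ff30f0, 190 l.): §1.  v1.1 (this file): ADDITIVE — one new import (`…B12CouplingClausesHistory`, Literature,
landed 2026-08-26), §2 appended after v1's last declaration, this header extended; every v1 declaration byte-identical.

HONEST FRAMING.  Count-neutral by-name knit; NOT a discharge of N22; no `RRec` home exists (R422 (A)(P2)).  Displayed clauses: the representation
clause = the W1 object (seat `node00-def-W1`); holomorphy under one (2.38)-majorant in an OLDER coupling = node N10's T-row read on a strip
(printed TYPE for the last coupling only, [I] p. 263); the last-coupling letter = node N09's `EHoloAt`; (O) = node N18.  NE5 ∕ NE9 NOT IN PRINT,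
NOT PROVED; instance on Bałaban's localized `E^{(j)}(X)` 0∕1; one finite four-torus programme at fixed ε — NOT infinite volume, NOT OS on ℝ⁴,
NOT a mass gap, NOT Clay.  0 `sorry`, 0 `def`, standard axioms.

References (TYPES only): [I] = [Balaban1987RG1] T. Bałaban, Commun. Math. Phys. **109** (1987) 249–301 — p. 263; [II] = [Balaban1988RG2Cluster]
T. Bałaban, Commun. Math. Phys. **116** (1988) 1–22 — (2.3) p. 12, (1.33) p. 9, (2.13)–(2.14) pp. 14–15, Lemma 3 (2.38) p. 20, (2.41) p. 21.
-/

noncomputable section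

namespace YMDAG.N22

open Set Metric
open scoped BigOperators ComplexConjugate
open Literature.MathematicalPhysics.QuantumFieldTheory.Balaban1983to89
open Literature.MathematicalPhysics.QuantumFieldTheory.Balaban1983to89.T4Continuum
open Literature.MathematicalPhysics.QuantumFieldTheory.Balaban1983to89.T4OutputRate
open Literature.MathematicalPhysics.QuantumFieldTheory.Balaban1983to89.B13Resummation (locE)
open Literature.MathematicalPhysics.QuantumFieldTheory.Balaban1983to89.TreeLengthTorus (TPt TDom tsys torusTreeLen)
open Literature.MathematicalPhysics.QuantumFieldTheory.Balaban1983to89.TreeLengthTorusGeometry (TTouch)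
open Literature.MathematicalPhysics.QuantumFieldTheory.Balaban1983to89.B12TreeDecay (K₀)
open Summit.QuantumFields.BalabanUV.T4Continuum.NE9.TowerCarriers (TowerData prepend)
open Summit.QuantumFields.BalabanUV.T4Continuum.NE1p.DressedOutputAnalyticFaces (analytic_and_bounded_locE_param_torus)
open YMDAG.UVSplit
open Literature.MathematicalPhysics.QuantumFieldTheory.Balaban1983to89.B12CouplingClausesHistory (AnalyticInEachCoupling266
  analyticInEachCoupling266_of_openDiscs)

/-! ## §1 The MIXED slot: older couplings at the ACTIVITY level, the LAST coupling at the OUTPUT level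

Print's dichotomy ([II] p. 12 (2.3): the small-field cut-off `χ(|B(b)| < ε₁∕g_k)` reads the LAST coupling only; an OLDER coupling `g_i`, `i < k`,
enters the activities (2.14) only through the potentials `𝐕_k(Y, B)` of the earlier actions, [II] (1.33) p. 9): complexifying an OLDER coupling
never meets the cut-off, so the activity-strip slot of §1 is the natural currency for `i < k`; for the last coupling `i = k` the natural currency
is the OUTPUT-level letter of [I] p. 263 *"(or analytic)"* (node N09's per-step `EHoloAt` delivery; seat n22-d's `…N22LastCouplingHolo`).  §1
glues the two: the (A) letter for EVERY young coupling from the activity-strip slot on the OLDER ones and an output-level (A) letter on the LAST one. -/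

open Classical in
/-- **MIXED PRODUCER: activity-strip slot on the OLDER couplings + an output-level sup letter on the LAST coupling ⟹ the (A) letter for every
young coupling** (common margin `r`, common constant `M ≥ max(e·9·64·K₀(64,8)²·A, M_last)`, `μ = 1`). [folklore] -/
theorem supLetter_of_activityStripOlder_lastLetter {C : Carriers} {Bg : Type} {E : Functional C Bg} (Nsz : ℕ → ℕ) [∀ j, NeZero (Nsz j)]
    {γ κ A R r₁ r M ML : ℝ} (hA0 : 0 ≤ A) (hr₁ : 0 ≤ r₁) (hrate : r₁ + 2 * (64 * Real.log 162) + 2 ≤ R)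
    (hsmall : A * Real.exp (5 * r₁ + 1) * K₀ 64 8 * 9 * 64 ≤ 1)
    (hMA : Real.exp 1 * 9 * 64 * K₀ 64 8 ^ 2 * A ≤ M) (hML : ML ≤ M)
    (hOlder : ∀ g ∈ Window γ, ∀ (U : Bg) (X : C.Dom) (i : ℕ), i + 1 < C.scale X →
      ∃ (X₀ : (tsys 4 (Nsz (C.scale X))).Dom) (Hc : ℂ → (tsys 4 (Nsz (C.scale X))).Dom → ℂ) (O : Set ℂ),
        IsOpen O ∧ (∀ t ∈ Ioc (0 : ℝ) γ, closedBall (t : ℂ) r ⊆ O) ∧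
        (∀ Z : (tsys 4 (Nsz (C.scale X))).Dom, Z.1 ⊆ X₀.1 → DifferentiableOn ℂ (fun z => Hc z Z) O) ∧
        (∀ z ∈ O, ∀ Z : (tsys 4 (Nsz (C.scale X))).Dom, Z.1 ⊆ X₀.1 → ‖Hc z Z‖ ≤ A * Real.exp (-(R * torusTreeLen Z.1))) ∧
        κ * C.d X ≤ r₁ * torusTreeLen X₀.1 ∧
        (∀ t ∈ Ioc (0 : ℝ) γ,
          (locE (TTouch (d := 4) (N := Nsz (C.scale X))) (fun Z : (tsys 4 (Nsz (C.scale X))).Dom => Z.1) (Hc t) X₀.1).re =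
            E (Function.update g i t) U X))
    (hLast : ∀ g ∈ Window γ, ∀ (U : Bg) (X : C.Dom) (i : ℕ), i + 1 = C.scale X → ∃ (F : ℂ → ℂ) (Dset : Set ℂ),
      DifferentiableOn ℂ F Dset ∧ (∀ z ∈ Dset, ‖F z‖ ≤ ML * Real.exp (-(κ * C.d X))) ∧
      (∀ t ∈ Ioc (0 : ℝ) γ, closedBall (t : ℂ) r ⊆ Dset) ∧ (∀ t ∈ Ioc (0 : ℝ) γ, F t = (E (Function.update g i t) U X : ℂ))) :
    ∀ g ∈ Window γ, ∀ (U : Bg) (X : C.Dom) (i : ℕ), i < C.scale X → ∃ (F : ℂ → ℂ) (Dset : Set ℂ),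
      DifferentiableOn ℂ F Dset ∧ (∀ z ∈ Dset, ‖F z‖ ≤ M * 1 ^ (C.scale X - 1 - i) * Real.exp (-(κ * C.d X))) ∧
      (∀ t ∈ Ioc (0 : ℝ) γ, closedBall (t : ℂ) r ⊆ Dset) ∧ (∀ t ∈ Ioc (0 : ℝ) γ, F t = (E (Function.update g i t) U X : ℂ)) := by
  intro g hg U X i hi
  have hexp : 0 ≤ Real.exp (-(κ * C.d X)) := Real.exp_nonneg _
  rcases Nat.lt_or_ge (i + 1) (C.scale X) with hlt | hge
  · -- an OLDER coupling: the activity-strip slot, through §1 applied to the functional restricted to this one clause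
    obtain ⟨X₀, Hc, O, hO, hdisc, hhol, hmaj, hcmp, hrep⟩ := hOlder g hg U X i hlt
    have key := analytic_and_bounded_locE_param_torus (N := Nsz (C.scale X)) (P := ℂ)
      (m := fun Z : (tsys 4 (Nsz (C.scale X))).Dom => A * Real.exp (-(R * torusTreeLen Z.1))) (act := Hc) (A := A) (R := R)
      (r₁ := r₁) X₀ hO hA0 hr₁ hrate hsmall hhol (fun z hz Z hZ => hmaj z hz Z hZ) (fun Z _ => le_rfl)
    have hB : ∀ z ∈ O, ‖locE (TTouch (d := 4) (N := Nsz (C.scale X))) (fun Z : (tsys 4 (Nsz (C.scale X))).Dom => Z.1) (Hc z) X₀.1‖ ≤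
        M * 1 ^ (C.scale X - 1 - i) * Real.exp (-(κ * C.d X)) := by
      intro z hz
      have hMnn : 0 ≤ Real.exp 1 * 9 * 64 * K₀ 64 8 ^ 2 * A := by positivity
      calc ‖locE (TTouch (d := 4) (N := Nsz (C.scale X))) (fun Z : (tsys 4 (Nsz (C.scale X))).Dom => Z.1) (Hc z) X₀.1‖
          ≤ Real.exp 1 * 9 * 64 * K₀ 64 8 ^ 2 * A * Real.exp (-(r₁ * torusTreeLen X₀.1)) := key.2 z hz
        _ ≤ Real.exp 1 * 9 * 64 * K₀ 64 8 ^ 2 * A * Real.exp (-(κ * C.d X)) :=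
            mul_le_mul_of_nonneg_left (Real.exp_le_exp.2 (neg_le_neg hcmp)) hMnn
        _ ≤ M * Real.exp (-(κ * C.d X)) := mul_le_mul_of_nonneg_right hMA hexp
        _ = M * 1 ^ (C.scale X - 1 - i) * Real.exp (-(κ * C.d X)) := by rw [one_pow, mul_one]
    exact exists_holo_extension_of_re (f := fun t => E (Function.update g i t) U X) hO key.1 hB hdisc hrep
  · -- the LAST coupling: the output-level letter, its constant weakened to `M`
    have hi1 : i + 1 = C.scale X := le_antisymm hi hge
    obtain ⟨F, Dset, hF, hB, hD, hf⟩ := hLast g hg U X i hi1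
    refine ⟨F, Dset, hF, fun z hz => ?_, hD, hf⟩
    calc ‖F z‖ ≤ ML * Real.exp (-(κ * C.d X)) := hB z hz
      _ ≤ M * Real.exp (-(κ * C.d X)) := mul_le_mul_of_nonneg_right hML hexp
      _ = M * 1 ^ (C.scale X - 1 - i) * Real.exp (-(κ * C.d X)) := by rw [one_pow, mul_one]

open Classical in
/-- **THE MIXED SLOT CARRIES `N22At`** (ROAD 3, rate `θ^{1−s}`): (P) + (O) at the bundle's NE5 rate `0 < θ ≤ 1` + the activity-strip slot on the
OLDER couplings + an output-level (A) letter with constant `M_last` on the LAST coupling, common margin `r`, common constant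
`M ≥ max(e·9·64·K₀(64,8)²·A, M_last)` with `C₀ ≤ 2M`, letters `ω = θ^{1−s}`, `Λ k i = C₉·ω^{k−i}`, `C₉ = (32∕(s²·min(r∕2, γ∕2)))·C₀^{1−s}(2M)^{s}∕ω`
— `n22At_of_oscAnalytic` at `μ = 1` BY NAME. [folklore] -/
theorem n22At_of_oscActivityStripOlder_lastLetter (u : U3Carriers) (Nsz : ℕ → ℕ) [∀ j, NeZero (Nsz j)] {C₀ A R r₁ r M ML s : ℝ}
    (hW : u.W = Window u.γ) (hP : PrefixDependenceOn u.EA (Window u.γ))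
    (hO : ∀ g ∈ Window u.γ, ∀ g' ∈ Window u.γ, ∀ (U : u.C.BgA) (X : u.C.Dom) (a : ℕ), a ≤ u.C.scale X →
      (∀ n, a ≤ n → g n = g' n) → |u.EA g U X - u.EA g' U X| ≤ C₀ * u.θ ^ (u.C.scale X - a) * Real.exp (-(u.κ * u.C.d X)))
    (hOlder : ∀ g ∈ Window u.γ, ∀ (U : u.C.BgA) (X : u.C.Dom) (i : ℕ), i + 1 < u.C.scale X →
      ∃ (X₀ : (tsys 4 (Nsz (u.C.scale X))).Dom) (Hc : ℂ → (tsys 4 (Nsz (u.C.scale X))).Dom → ℂ) (O : Set ℂ),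
        IsOpen O ∧ (∀ t ∈ Ioc (0 : ℝ) u.γ, closedBall (t : ℂ) r ⊆ O) ∧
        (∀ Z : (tsys 4 (Nsz (u.C.scale X))).Dom, Z.1 ⊆ X₀.1 → DifferentiableOn ℂ (fun z => Hc z Z) O) ∧
        (∀ z ∈ O, ∀ Z : (tsys 4 (Nsz (u.C.scale X))).Dom, Z.1 ⊆ X₀.1 → ‖Hc z Z‖ ≤ A * Real.exp (-(R * torusTreeLen Z.1))) ∧
        u.κ * u.C.d X ≤ r₁ * torusTreeLen X₀.1 ∧
        (∀ t ∈ Ioc (0 : ℝ) u.γ,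
          (locE (TTouch (d := 4) (N := Nsz (u.C.scale X))) (fun Z : (tsys 4 (Nsz (u.C.scale X))).Dom => Z.1) (Hc t) X₀.1).re =
            u.EA (Function.update g i t) U X))
    (hLast : ∀ g ∈ Window u.γ, ∀ (U : u.C.BgA) (X : u.C.Dom) (i : ℕ), i + 1 = u.C.scale X → ∃ (F : ℂ → ℂ) (Dset : Set ℂ),
      DifferentiableOn ℂ F Dset ∧ (∀ z ∈ Dset, ‖F z‖ ≤ ML * Real.exp (-(u.κ * u.C.d X))) ∧
      (∀ t ∈ Ioc (0 : ℝ) u.γ, closedBall (t : ℂ) r ⊆ Dset) ∧ (∀ t ∈ Ioc (0 : ℝ) u.γ, F t = (u.EA (Function.update g i t) U X : ℂ)))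
    (hA0 : 0 ≤ A) (hr₁ : 0 ≤ r₁) (hrate : r₁ + 2 * (64 * Real.log 162) + 2 ≤ R)
    (hsmall : A * Real.exp (5 * r₁ + 1) * K₀ 64 8 * 9 * 64 ≤ 1)
    (hMA : Real.exp 1 * 9 * 64 * K₀ 64 8 ^ 2 * A ≤ M) (hML : ML ≤ M) (hM : 0 < M)
    (hC₀ : 0 < C₀) (hθ : 0 < u.θ) (hθ1 : u.θ ≤ 1) (hCM : C₀ ≤ 2 * M) (hr : 0 < r) (hγ : 0 < u.γ) (hs0 : 0 < s) (hs1 : s < 1)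
    (hω : u.ω = u.θ ^ (1 - s)) (hΛ : u.Λ = fun k i => u.C₉ * u.ω ^ (k - i))
    (hC₉ : u.C₉ = 32 / (s ^ 2 * min (r / 2) (u.γ / 2)) * (C₀ ^ (1 - s) * (2 * M) ^ s) / u.θ ^ (1 - s)) :
    N22At u := by
  have hA := supLetter_of_activityStripOlder_lastLetter (E := u.EA) Nsz hA0 hr₁ hrate hsmall hMA hML hOlder hLast
  have hω' : u.ω = u.θ ^ (1 - s) * (1 : ℝ) ^ s := by rw [Real.one_rpow, mul_one]; exact hω
  have hC₉' : u.C₉ = 32 / (s ^ 2 * min (r / 2) (u.γ / 2)) * (C₀ ^ (1 - s) * (2 * M) ^ s) / (u.θ ^ (1 - s) * (1 : ℝ) ^ s) := by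
    rw [Real.one_rpow, mul_one]; exact hC₉
  exact n22At_of_oscAnalytic u hW hP hO hA hC₀ hθ hM hθ1 hCM hr hγ hs0 hs1 hω' hΛ hC₉'

open Classical in
/-- **THE MIXED SLOT ALONG THE TOWER**: node N18 BY NAME at the levels `k′ < k` + (P) + the activity-strip slot on the OLDER couplings + an
output-level (A) letter on the LAST coupling at level `k` (common `r`, common `M ≥ max(e·9·64·K₀(64,8)²·A, M_last)`, `2C₅∕(1−θ) ≤ 2M`) ⟹
`N22At` of the level bundle with ROAD 3's letters at `μ = 1` — `n22At_level_of_n18At_below_analytic` BY NAME. [folklore] -/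
theorem n22At_level_of_n18At_below_activityStripOlder_lastLetter (T : TowerData) (E : ℕ → (ℕ → ℝ) → T.B → T.Dom → ℝ) (Nsz : ℕ → ℕ)
    [∀ j, NeZero (Nsz j)] {γ κ θ C₅ A R r₁ r M ML s cr ρ' : ℝ}
    (hC : 0 < C₅) (hθ0 : 0 < θ) (hθ1 : θ < 1) (k : ℕ)
    (h18 : ∀ k' : ℕ, k' < k →
      N18At ⟨T.level k', Window γ, γ, κ, E k', fun b g U X => E (k' + 1) (prepend b g) U X, θ, C₅,
        fun a i => 32 / (s ^ 2 * min (r / 2) (γ / 2)) * ((2 * C₅ / (1 - θ)) ^ (1 - s) * (2 * M) ^ s) / (θ ^ (1 - s) * (1 : ℝ) ^ s) *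
          (θ ^ (1 - s) * (1 : ℝ) ^ s) ^ (a - i),
        32 / (s ^ 2 * min (r / 2) (γ / 2)) * ((2 * C₅ / (1 - θ)) ^ (1 - s) * (2 * M) ^ s) / (θ ^ (1 - s) * (1 : ℝ) ^ s),
        θ ^ (1 - s) * (1 : ℝ) ^ s, cr, ρ'⟩)
    (hP : PrefixDependenceOn (C := T.level k) (E k) (Window γ))
    (hOlder : ∀ g ∈ Window γ, ∀ (U : (T.level k).BgA) (X : (T.level k).Dom) (i : ℕ), i + 1 < (T.level k).scale X →
      ∃ (X₀ : (tsys 4 (Nsz ((T.level k).scale X))).Dom) (Hc : ℂ → (tsys 4 (Nsz ((T.level k).scale X))).Dom → ℂ) (O : Set ℂ),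
        IsOpen O ∧ (∀ t ∈ Ioc (0 : ℝ) γ, closedBall (t : ℂ) r ⊆ O) ∧
        (∀ Z : (tsys 4 (Nsz ((T.level k).scale X))).Dom, Z.1 ⊆ X₀.1 → DifferentiableOn ℂ (fun z => Hc z Z) O) ∧
        (∀ z ∈ O, ∀ Z : (tsys 4 (Nsz ((T.level k).scale X))).Dom, Z.1 ⊆ X₀.1 → ‖Hc z Z‖ ≤ A * Real.exp (-(R * torusTreeLen Z.1))) ∧
        κ * (T.level k).d X ≤ r₁ * torusTreeLen X₀.1 ∧
        (∀ t ∈ Ioc (0 : ℝ) γ,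
          (locE (TTouch (d := 4) (N := Nsz ((T.level k).scale X))) (fun Z : (tsys 4 (Nsz ((T.level k).scale X))).Dom => Z.1)
            (Hc t) X₀.1).re = E k (Function.update g i t) U X))
    (hLast : ∀ g ∈ Window γ, ∀ (U : (T.level k).BgA) (X : (T.level k).Dom) (i : ℕ), i + 1 = (T.level k).scale X →
      ∃ (F : ℂ → ℂ) (Dset : Set ℂ), DifferentiableOn ℂ F Dset ∧ (∀ z ∈ Dset, ‖F z‖ ≤ ML * Real.exp (-(κ * (T.level k).d X))) ∧
      (∀ t ∈ Ioc (0 : ℝ) γ, closedBall (t : ℂ) r ⊆ Dset) ∧ (∀ t ∈ Ioc (0 : ℝ) γ, F t = (E k (Function.update g i t) U X : ℂ)))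
    (hA0 : 0 ≤ A) (hr₁ : 0 ≤ r₁) (hrate : r₁ + 2 * (64 * Real.log 162) + 2 ≤ R)
    (hsmall : A * Real.exp (5 * r₁ + 1) * K₀ 64 8 * 9 * 64 ≤ 1)
    (hMA : Real.exp 1 * 9 * 64 * K₀ 64 8 ^ 2 * A ≤ M) (hML : ML ≤ M) (hM : 0 < M)
    (hCM : 2 * C₅ / (1 - θ) ≤ 2 * M) (hr : 0 < r) (hγ : 0 < γ) (hs0 : 0 < s) (hs1 : s < 1) :
    N22At ⟨T.level k, Window γ, γ, κ, E k, fun b g U X => E (k + 1) (prepend b g) U X, θ, C₅,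
      fun a i => 32 / (s ^ 2 * min (r / 2) (γ / 2)) * ((2 * C₅ / (1 - θ)) ^ (1 - s) * (2 * M) ^ s) / (θ ^ (1 - s) * (1 : ℝ) ^ s) *
        (θ ^ (1 - s) * (1 : ℝ) ^ s) ^ (a - i),
      32 / (s ^ 2 * min (r / 2) (γ / 2)) * ((2 * C₅ / (1 - θ)) ^ (1 - s) * (2 * M) ^ s) / (θ ^ (1 - s) * (1 : ℝ) ^ s),
      θ ^ (1 - s) * (1 : ℝ) ^ s, cr, ρ'⟩ := by
  have hA := supLetter_of_activityStripOlder_lastLetter (C := T.level k) (E := E k) Nsz hA0 hr₁ hrate hsmall hMA hML hOlder hLast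
  exact n22At_level_of_n18At_below_analytic T E hC hθ0 hθ1 k h18 hP hA hM hθ1.le hCM hr hγ hs0 hs1

/-! ## §2 (v1.1) The direction of record: the activity-strip slot implies the PRINTED clause of [I] p. 266 -/

open Classical in
/-- **THE ACTIVITY-STRIP SLOT ⟹ PRINT'S p. 266 TYPE** ([I] p. 266, after (2.9): *"𝐄^{(j)}, β_j are analytic functions of the effective coupling
constants"*, read coordinatewise and history-explicitly by the literature typer as `AnalyticInEachCoupling266`): under the activity-strip slot of
`supLetter_of_activityStrip` (margin `r > 0`) every young-coupling section `s ↦ EA (g | g_i := s) U X` is real-analytic on `]0, γ]` — the (A) letter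
restricted to open discs, then `B12CouplingClausesHistory.analyticInEachCoupling266_of_openDiscs` BY NAME.  Only this direction is claimed.
[cite: Balaban1987RG1, §2 p.266 (sentence after (2.9))] -/
theorem analyticInEachCoupling266_of_activityStrip {C : Carriers} {Bg : Type} {E : Functional C Bg} (Nsz : ℕ → ℕ) [∀ j, NeZero (Nsz j)]
    {γ κ A R r₁ r : ℝ} (hA0 : 0 ≤ A) (hr₁ : 0 ≤ r₁) (hrate : r₁ + 2 * (64 * Real.log 162) + 2 ≤ R)
    (hsmall : A * Real.exp (5 * r₁ + 1) * K₀ 64 8 * 9 * 64 ≤ 1) (hr : 0 < r)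
    (hAct : ∀ g ∈ Window γ, ∀ (U : Bg) (X : C.Dom) (i : ℕ), i < C.scale X →
      ∃ (X₀ : (tsys 4 (Nsz (C.scale X))).Dom) (Hc : ℂ → (tsys 4 (Nsz (C.scale X))).Dom → ℂ) (O : Set ℂ),
        IsOpen O ∧ (∀ t ∈ Ioc (0 : ℝ) γ, closedBall (t : ℂ) r ⊆ O) ∧
        (∀ Z : (tsys 4 (Nsz (C.scale X))).Dom, Z.1 ⊆ X₀.1 → DifferentiableOn ℂ (fun z => Hc z Z) O) ∧
        (∀ z ∈ O, ∀ Z : (tsys 4 (Nsz (C.scale X))).Dom, Z.1 ⊆ X₀.1 → ‖Hc z Z‖ ≤ A * Real.exp (-(R * torusTreeLen Z.1))) ∧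
        κ * C.d X ≤ r₁ * torusTreeLen X₀.1 ∧
        (∀ t ∈ Ioc (0 : ℝ) γ,
          (locE (TTouch (d := 4) (N := Nsz (C.scale X))) (fun Z : (tsys 4 (Nsz (C.scale X))).Dom => Z.1) (Hc t) X₀.1).re =
            E (Function.update g i t) U X)) :
    AnalyticInEachCoupling266 (Window γ) (Ioc 0 γ) C.scale (fun _ => (Set.univ : Set Bg)) E := by
  have hA := supLetter_of_activityStrip (E := E) Nsz hA0 hr₁ hrate hsmall hAct
  refine analyticInEachCoupling266_of_openDiscs hr fun g hg U X i hi => ?_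
  obtain ⟨F, D, hF, -, hD, hf⟩ := hA g hg U X i hi
  exact ⟨F, D, hF, fun t ht => ball_subset_closedBall.trans (hD t ht), hf⟩

end YMDAG.N22

end
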